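import Literature.NumberTheory.GaloisRepresentations.IdeleClassBarLatticeVanishing
import Literature.Algebra.Homology.DiscreteRepFreePresentation
import Literature.Algebra.Homology.DiscreteRepTateDuality
import HarnessLib

/-!
# Tate's duality theorem for the idèle class formation `(Γ_F, C̄)` MODULO THE GLOBAL INVARIANT MAP: the three
# cohomological hypotheses (`H¹ = 0`, `Hʳ = 0 (r ≥ 3)`, Lemma 1.9) are tree theorems, so the theorem holds for
# any `inv` with `inv_U` bijective and `α¹(U, ℤ/m)` bijective (Milne ADT I Thm. 1.8 / Lemma 1.9; Harari 16.21)

Topic `NumberTheory/GaloisRepresentations`; namespace `Literature.NumberTheory.GaloisRepresentations.IdeleClassBar`.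
Theorems only; no definition, no named fact, no instance, no `sorry`.  Assembly of door-c4's abstract duality theorem
(`DiscreteRepTateDuality`: `TateDualityHypotheses`, `tateDuality_finite`, `adjointMap_one_injective`; its reduction
`DiscreteRepFreePresentation.tateDualityHypotheses_of_torsionFree`, Lemma 1.9) with door-c6 g15's discharges for
`C̄ = classBarD F` (`IdeleClassBarSubgroupHOne`: `ext_one_res_classBarD_eq_zero_openNormal`; `IdeleClassBarSubgroupHThree`:
`ext_res_classBarD_eq_zero_of_three_le_openNormal`; `IdeleClassBarLatticeVanishing`: `ext_classBarD_eq_zero_of_torsionFree`).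

THE POINT.  Of the seven fields of `TateDualityHypotheses (classBarD F) inv` (USE-door-c4-g15 §1): `baer` is a property of
`Q`; `ext_one_triv_eq_zero` is door-c4's `ext_one_triv_int_eq_zero_openSubgroup`; `ext_one_eq_zero`,
`ext_triv_eq_zero_of_three_le` and (through Lemma 1.9) `ext_eq_zero_of_four_le` are THIS CELL'S THEOREMS about the idèle
class formation and hold for ANY `inv`; the two remaining fields `invAt_bijective` and `adjointBijective_one_zmod` concern
the global invariant map `inv_F : H²(Γ_F, C̄) ≅ ℚ/ℤ` (door-c4 g16 / door-c5, in progress).  Hence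
**`tateDualityHypotheses_classBarD`**: for every `inv : Ext²_{C_Γ}(ℤ, C̄) →+ Q` (`Q` injective) whose local invariants
`inv_U = inv ∘ cores_U` are bijective and for which Milne's (b) `α¹(U, ℤ/m)` holds, `TateDualityHypotheses (classBarD F) inv`;
consequently (**`tateDuality_classBarD`**, **`adjointMap_one_injective_classBarD`**) `α²(Γ_F, M)`, `α¹(Γ_F, M)` are
bijective and `Ext³(M, C̄) = 0` for every finite discrete `M`, and `α¹(Γ_F, M)` is injective — the input of Milne I
4.10 (b) `Ker γ¹ ⊆ Im β¹` (hE) — as soon as the invariant map is supplied.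

HONEST FRAMING: conditional on the two invariant-map hypotheses (stated as explicit hypotheses, not named facts); no
case of Poitou–Tate duality and no case of BSD is proved here.

## References
* J. S. Milne, *Arithmetic Duality Theorems* (2nd ed. 2006), I §1, Theorem 1.8, Lemma 1.9; §4, Theorem 4.10. [MilneADT2006]
* D. Harari, *Galois Cohomology and Class Field Theory* (2020), §16.3 Theorem 16.21. [Harari2020]
-/

noncomputable section

open CategoryTheory CategoryTheory.Abelian
open Field (absoluteGaloisGroup)
open Literature.Algebra.Homology Literature.Algebra.Homology.DiscreteRep Literature.Algebra.Homology.ExtDuality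
open scoped Classical

namespace Literature.NumberTheory.GaloisRepresentations

namespace IdeleClassBar

variable {F : Type} [Field F] [NumberField F] {Q : Type} [AddCommGroup Q]
  (inv : Ext (DiscreteRep.triv (k := ℤ) (Γ := absoluteGaloisGroup F) ℤ) (classBarD F) 2 →+ Q)

/-- **`TateDualityHypotheses (classBarD F) inv` from the invariant-map hypotheses alone**: the cohomological fields
(`H¹(U, C̄) = 0`, `Hʳ(U, C̄) = 0` for `r ≥ 3`, Lemma 1.9 `Extʳ(N, C̄) = 0`) are supplied by the cell's theorems on the
idèle class formation. [cite: MilneADT2006, I Theorem 1.8, Lemma 1.9][cite: Harari2020, §16.3 Theorem 16.21] -/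
theorem tateDualityHypotheses_classBarD (baer : Module.Baer ℤ Q)
    (invAt_bijective : ∀ U : OpenNormalSubgroup (absoluteGaloisGroup F),
      Function.Bijective (invAt (classBarD F) inv U))
    (adjointBijective_one_zmod : ∀ (U : OpenNormalSubgroup (absoluteGaloisGroup F)) (m : ℕ), 0 < m →
      AdjointBijective (invAt (classBarD F) inv U)
        (DiscreteRep.triv (k := ℤ) (Γ := (U : Subgroup (absoluteGaloisGroup F))) (ZMod m))
        (show 1 + 1 = 2 from rfl)) :
    TateDualityHypotheses (classBarD F) inv :=
  tateDualityHypotheses_of_torsionFree baer invAt_bijective ext_one_res_classBarD_eq_zero_openNormal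
    ext_res_classBarD_eq_zero_of_three_le_openNormal adjointBijective_one_zmod
    ext_classBarD_eq_zero_of_torsionFree

/-- **Tate duality for `(Γ_F, C̄)` modulo the invariant map**: for every finite discrete `Γ_F`-module `M`,
`α²(Γ_F, M)` and `α¹(Γ_F, M)` are bijective and `Ext³_{C_Γ}(M, C̄) = 0`.
[cite: MilneADT2006, I Theorem 1.8][cite: Harari2020, §16.3 Theorem 16.21] -/
theorem tateDuality_classBarD (baer : Module.Baer ℤ Q)
    (invAt_bijective : ∀ U : OpenNormalSubgroup (absoluteGaloisGroup F),
      Function.Bijective (invAt (classBarD F) inv U))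
    (adjointBijective_one_zmod : ∀ (U : OpenNormalSubgroup (absoluteGaloisGroup F)) (m : ℕ), 0 < m →
      AdjointBijective (invAt (classBarD F) inv U)
        (DiscreteRep.triv (k := ℤ) (Γ := (U : Subgroup (absoluteGaloisGroup F))) (ZMod m))
        (show 1 + 1 = 2 from rfl))
    (M : DiscreteRepCat ℤ (absoluteGaloisGroup F)) [Finite M.obj.V] :
    AdjointBijective inv M (show 0 + 2 = 2 from rfl) ∧ AdjointBijective inv M (show 1 + 1 = 2 from rfl) ∧
      ∀ x : Ext M (classBarD F) 3, x = 0 :=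
  tateDuality_finite (tateDualityHypotheses_classBarD inv baer invAt_bijective adjointBijective_one_zmod) M

/-- **The input of Milne I 4.10 (b) for `(Γ_F, C̄)` modulo the invariant map**: for `M` finite,
`Ext¹_{C_Γ}(M, C̄) → Hom(Ext¹_{C_Γ}(ℤ, M), Q)` is injective. [cite: MilneADT2006, I Theorem 1.8 (b) and Theorem 4.10 (proof)] -/
theorem adjointMap_one_injective_classBarD (baer : Module.Baer ℤ Q)
    (invAt_bijective : ∀ U : OpenNormalSubgroup (absoluteGaloisGroup F),
      Function.Bijective (invAt (classBarD F) inv U))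
    (adjointBijective_one_zmod : ∀ (U : OpenNormalSubgroup (absoluteGaloisGroup F)) (m : ℕ), 0 < m →
      AdjointBijective (invAt (classBarD F) inv U)
        (DiscreteRep.triv (k := ℤ) (Γ := (U : Subgroup (absoluteGaloisGroup F))) (ZMod m))
        (show 1 + 1 = 2 from rfl))
    (M : DiscreteRepCat ℤ (absoluteGaloisGroup F)) [Finite M.obj.V] :
    Function.Injective (adjointMap inv M (show 1 + 1 = 2 from rfl)) :=
  adjointMap_one_injective (tateDualityHypotheses_classBarD inv baer invAt_bijective adjointBijective_one_zmod) M

end IdeleClassBar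

end Literature.NumberTheory.GaloisRepresentations

end
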